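import Mathlib

/-!
# Route `UniversalCells` — shared definitions for the crux `Universality` (stmt-ResolutionOfSingularities-15234)

Objects posited by the route's crux #7 `UniversalCells.Universality` (Mnëv–Lafforgue–Lee–Vakil
universality, matrix form over the prime field) and by the registered stubs of its line `birth`
(`Cruxes/Universality/Lines/birth.lean`, reshaped by the lead 2026-08-17): every definition here is a
reducible abbreviation of a sub-expression of the crux statement (`tautMatrix`, `minorIdeal`,
`StratumRing` are its `let`-bound data verbatim; `StratumRing p m Γp Γ0 = StratumRing' p (Fin m) Γp Γ0`
holds by `rfl`), of the elementary presentations of Lee–Vakil 2012 §2 eq. (e:fg) (`elemIdeal`,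
`ElemRing`), of the Gelfand–MacPherson normalisation of the affine chart `p_123 ≠ 0` of `Gr(3, 3+m)`
(`entrySel`, `designatedSels`, `normMatrix`, `normMinor`, `normIdeal`, `NormRing`, `TorusRing`;
Hu 2021 Prop. 9.1 / Thm. 9.3, Lafforgue 2003 Thm. I.11), and of the explicit von Staudt point
configuration encoding an elementary presentation (`Kol`, `dRow`, `colF … colM`, `config`;
Lee–Vakil 2012 §3, Mnëv 1988). The only theorem is the definitional glue `stub_stratumRingDefs` (`rfl`); the stub files
`UniversalCellsUniversality*.lean` import this file so that their statements are literally the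
registered stub signatures.

Design choice: PARTIAL strata (the crux lets `Γ₀` be any set and `Γ₊` any finite set of column
triples), so `config` imposes exactly the incidences the encoding needs and `designatedSels` inverts
exactly one homogeneous coordinate per column plus the frame; nothing else is constrained.
-/

noncomputable section

-- single-problem summit: the doubled namespace component `ResolutionOfSingularities` is forced
set_option linter.dupNamespace false

namespace Summit.ResolutionOfSingularities.ResolutionOfSingularities.Theorems.UniversalCells

/-! ## The objects of the cut (reducible abbreviations of the crux's `let`-bound data) -/

/-- The tautological `3 × (3+m)` matrix `[I₃ | A]` over `𝔽_p[a_ij : 3 × m]` — verbatim the crux's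
`let M`. [cite: Hu2021, §2 (the chart `p_m ≠ 0` of `Gr(3,n)`)] -/
abbrev tautMatrix (p m : ℕ) :
    Matrix (Fin 3) (Fin 3 ⊕ Fin m) (MvPolynomial (Fin 3 × Fin m) (ZMod p)) :=
  Matrix.fromCols 1 (Matrix.of fun i j => MvPolynomial.X (i, j))

/-- The ideal of the `3 × 3` minors of `[I₃ | A]` indexed by `Γ0` — verbatim the crux's `let I`.
[cite: Hu2021, Prop. 9.1] -/
abbrev minorIdeal (p m : ℕ) (Γ0 : Set (Fin 3 → Fin 3 ⊕ Fin m)) :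
    Ideal (MvPolynomial (Fin 3 × Fin m) (ZMod p)) :=
  Ideal.span ((fun u : Fin 3 → Fin 3 ⊕ Fin m => ((tautMatrix p m).submatrix id u).det) '' Γ0)

/-- Coordinate ring `S(p, m, Γ₊, Γ₀)` of the PARTIAL MATROID STRATUM `P(p, m, Γ₊, Γ₀)` — verbatim the
ring whose `Spec` the crux's open immersion `i` lands in. [cite: Hu2021, Prop. 9.1, Thm. 9.4] -/
abbrev StratumRing (p m : ℕ) (Γp : Finset (Fin 3 → Fin 3 ⊕ Fin m))
    (Γ0 : Set (Fin 3 → Fin 3 ⊕ Fin m)) : Type :=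
  Localization.Away (Ideal.Quotient.mk (minorIdeal p m Γ0)
    (∏ u ∈ Γp, ((tautMatrix p m).submatrix id u).det))

/-- The ideal of ELEMENTARY relations on `N` generators over `ZMod p`: `x_i + x_j − x_k` for
`(i, j, k) ∈ Eadd`, `x_i · x_j − x_k` for `(i, j, k) ∈ Emul`, `x_i − 1` for `i ∈ Eone`.
[cite: LeeVakil2012, §2, eq. (e:fg)] -/
abbrev elemIdeal (p N : ℕ) (Eadd Emul : Finset (Fin N × Fin N × Fin N)) (Eone : Finset (Fin N)) :
    Ideal (MvPolynomial (Fin N) (ZMod p)) :=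
  Ideal.span
    ((fun t : Fin N × Fin N × Fin N =>
        (MvPolynomial.X t.1 + MvPolynomial.X t.2.1 - MvPolynomial.X t.2.2 :
          MvPolynomial (Fin N) (ZMod p))) '' ↑Eadd ∪
      (fun t : Fin N × Fin N × Fin N =>
        (MvPolynomial.X t.1 * MvPolynomial.X t.2.1 - MvPolynomial.X t.2.2 :
          MvPolynomial (Fin N) (ZMod p))) '' ↑Emul ∪
      (fun i : Fin N => (MvPolynomial.X i - 1 : MvPolynomial (Fin N) (ZMod p))) '' ↑Eone)

/-- The ELEMENTARY RING `B(p, N, E) = (ZMod p)[x_1, …, x_N] ⧸ ⟨E⟩`. [cite: LeeVakil2012, §2] -/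
abbrev ElemRing (p N : ℕ) (Eadd Emul : Finset (Fin N × Fin N × Fin N)) (Eone : Finset (Fin N)) :
    Type :=
  MvPolynomial (Fin N) (ZMod p) ⧸ elemIdeal p N Eadd Emul Eone

/-! ## Generic column index (for reindexing and torus splitting) -/

/-- The tautological matrix `[I₃ | A]` over an arbitrary column index type `κ`
(`tautMatrix p m = tautMatrix' p (Fin m)` syntactically). [folklore] -/
abbrev tautMatrix' (p : ℕ) (κ : Type) :
    Matrix (Fin 3) (Fin 3 ⊕ κ) (MvPolynomial (Fin 3 × κ) (ZMod p)) :=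
  Matrix.fromCols 1 (Matrix.of fun i j => MvPolynomial.X (i, j))

/-- The `3 × 3` minor of `[I₃ | A]` on the column triple `u`. [folklore] -/
abbrev minor' (p : ℕ) (κ : Type) (u : Fin 3 → Fin 3 ⊕ κ) : MvPolynomial (Fin 3 × κ) (ZMod p) :=
  ((tautMatrix' p κ).submatrix id u).det

/-- The partial stratum ring over an arbitrary finite column index type `κ`
(`StratumRing p m Γp Γ0 = StratumRing' p (Fin m) Γp Γ0` by `rfl`). [folklore] -/
abbrev StratumRing' (p : ℕ) (κ : Type) (Γp : Finset (Fin 3 → Fin 3 ⊕ κ))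
    (Γ0 : Set (Fin 3 → Fin 3 ⊕ κ)) : Type :=
  Localization.Away (Ideal.Quotient.mk (Ideal.span (minor' p κ '' Γ0)) (∏ u ∈ Γp, minor' p κ u))

/-- The crux's stratum ring IS the generic-index stratum ring at `κ = Fin m` (definitional; this is
the registered glue stub `stub_stratumRingDefs` under which this definitions file lands). [folklore] -/
theorem stub_stratumRingDefs (p m : ℕ) (Γp : Finset (Fin 3 → Fin 3 ⊕ Fin m))
    (Γ0 : Set (Fin 3 → Fin 3 ⊕ Fin m)) : StratumRing p m Γp Γ0 = StratumRing' p (Fin m) Γp Γ0 :=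
  rfl

/-- Selector of the minor "two identity columns complementary to row `i`, then column `c`": its
determinant is `± (entry (i, c))`. [folklore] -/
abbrev entrySel (κ : Type) (i : Fin 3) (c : κ) : Fin 3 → Fin 3 ⊕ κ :=
  ![Sum.inl (i.succAbove 0), Sum.inl (i.succAbove 1), Sum.inr c]

/-- The DESIGNATED selectors for `κ = Unit ⊕ κ'`: the three entries of the frame column `Unit` and
the entry `(d c, c)` of every other column. [cite: Hu2021, p. 64 ("system of local parameters")] -/
abbrev designatedSels (κ' : Type) [Fintype κ'] [DecidableEq κ'] (d : κ' → Fin 3) :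
    Finset (Fin 3 → Fin 3 ⊕ (Unit ⊕ κ')) :=
  (Finset.univ.image fun i : Fin 3 => entrySel (Unit ⊕ κ') i (Sum.inl ())) ∪
    (Finset.univ.image fun c : κ' => entrySel (Unit ⊕ κ') (d c) (Sum.inr c))

/-- The NORMALISED tautological matrix `[I₃ | 𝟙 | (n_ic)]`: frame column all ones, the other
columns free (the designated entries are set to `1` by `normIdeal`). [cite: Hu2021, Prop. 9.1] -/
abbrev normMatrix (p : ℕ) (κ' : Type) :
    Matrix (Fin 3) (Fin 3 ⊕ (Unit ⊕ κ')) (MvPolynomial (Fin 3 × κ') (ZMod p)) :=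
  Matrix.fromCols 1 (Matrix.fromCols (Matrix.of fun _ _ => 1)
    (Matrix.of fun i c => MvPolynomial.X (i, c)))

/-- The `3 × 3` minor of the normalised matrix on the column triple `u`. [folklore] -/
abbrev normMinor (p : ℕ) (κ' : Type) (u : Fin 3 → Fin 3 ⊕ (Unit ⊕ κ')) :
    MvPolynomial (Fin 3 × κ') (ZMod p) :=
  ((normMatrix p κ').submatrix id u).det

/-- The ideal of the normalised stratum: designated entries equal to one, `Γ₀`-minors of the
normalised matrix vanish. [cite: Hu2021, Prop. 9.1] -/
abbrev normIdeal (p : ℕ) (κ' : Type) (d : κ' → Fin 3) (Γ0 : Set (Fin 3 → Fin 3 ⊕ (Unit ⊕ κ'))) :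
    Ideal (MvPolynomial (Fin 3 × κ') (ZMod p)) :=
  Ideal.span (Set.range (fun c : κ' => (MvPolynomial.X (d c, c) - 1 : MvPolynomial (Fin 3 × κ') (ZMod p)))
    ∪ normMinor p κ' '' Γ0)

/-- The NORMALISED STRATUM RING `𝔽_p[n_ic] ⧸ normIdeal`. [cite: Hu2021, Prop. 9.1] -/
abbrev NormRing (p : ℕ) (κ' : Type) (d : κ' → Fin 3) (Γ0 : Set (Fin 3 → Fin 3 ⊕ (Unit ⊕ κ'))) :
    Type :=
  MvPolynomial (Fin 3 × κ') (ZMod p) ⧸ normIdeal p κ' d Γ0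

/-- The split torus coordinate ring `R[X_t : t ∈ T][1 / ∏ X_t]` (Laurent polynomials). [folklore] -/
abbrev TorusRing (T : Type) [Fintype T] (R : Type) [CommRing R] : Type :=
  Localization.Away (∏ t : T, (MvPolynomial.X t : MvPolynomial T R))

/-! ## The von Staudt configuration of an elementary presentation -/

/-- Column index of the configuration besides the frame column: three constants
(`0 ↦ C1 = (1:1:0)`, `1 ↦ D1 = (1:0:1)`, `2 ↦ X = (0:−1:1)`), one value column `V_i = (x_i:1:0)`
per generator, two columns `Qa_r, H_r` per triple `r` (addition gadget) and three columns
`Qm_r, R_r, Q'_r` per triple (multiplication gadget). [cite: LeeVakil2012, §3 (configurations for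
addition and multiplication)] -/
abbrev Kol (N : ℕ) : Type :=
  Fin 3 ⊕ Fin N ⊕ (Fin N × Fin N × Fin N) × Fin 2 ⊕ (Fin N × Fin N × Fin N) × Fin 3

/-- Designated (normalised-to-one) row of each configuration column: `C1 ↦ 1`, `D1 ↦ 2`, `X ↦ 2`,
`V_i ↦ 1`, `Qa_r ↦ 2`, `H_r ↦ 1`, `Qm_r, R_r, Q'_r ↦ 2`. [folklore] -/
abbrev dRow (N : ℕ) : Kol N → Fin 3 :=
  fun c => Sum.elim ![1, 2, 2] (Sum.elim (fun _ => 1)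
    (Sum.elim (fun rk => if rk.2 = 0 then 2 else 1) (fun _ => 2))) c

section Config
variable (N : ℕ)

/-- frame column `F = (1:1:1)` as a column of `[I₃ | F | Kol]` -/
abbrev colF : Fin 3 ⊕ (Unit ⊕ Kol N) := Sum.inr (Sum.inl ())
/-- identity column `e_i` -/
abbrev colE (i : Fin 3) : Fin 3 ⊕ (Unit ⊕ Kol N) := Sum.inl i
/-- constant column `C1 = (1:1:0)` -/
abbrev colC1 : Fin 3 ⊕ (Unit ⊕ Kol N) := Sum.inr (Sum.inr (Sum.inl 0))
/-- constant column `D1 = (1:0:1)` -/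
abbrev colD1 : Fin 3 ⊕ (Unit ⊕ Kol N) := Sum.inr (Sum.inr (Sum.inl 1))
/-- constant column `X = (0:−1:1)` -/
abbrev colX : Fin 3 ⊕ (Unit ⊕ Kol N) := Sum.inr (Sum.inr (Sum.inl 2))
/-- value column `V_i = (x_i:1:0)` -/
abbrev colV (i : Fin N) : Fin 3 ⊕ (Unit ⊕ Kol N) := Sum.inr (Sum.inr (Sum.inr (Sum.inl i)))
/-- addition-gadget column `k` of triple `r`: `0 ↦ Qa_r = (x_j:0:1)`, `1 ↦ H_r = (x_i+x_j:1:1)` -/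
abbrev colA (r : Fin N × Fin N × Fin N) (k : Fin 2) : Fin 3 ⊕ (Unit ⊕ Kol N) :=
  Sum.inr (Sum.inr (Sum.inr (Sum.inr (Sum.inl (r, k)))))
/-- multiplication-gadget column `k` of triple `r`: `0 ↦ Qm_r = (x_j:0:1)`, `1 ↦ R_r = (0:−x_j:1)`,
`2 ↦ Q'_r = (x_i x_j:0:1)` -/
abbrev colM (r : Fin N × Fin N × Fin N) (k : Fin 3) : Fin 3 ⊕ (Unit ⊕ Kol N) :=
  Sum.inr (Sum.inr (Sum.inr (Sum.inr (Sum.inr (r, k)))))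

/-- The imposed incidences `Γ₀` of the von Staudt configuration (every selector lists three columns
of `[I₃ | F | Kol N]`; "entry" selectors are `entrySel`):
constants — `C1₃ = 0`, `det(e₃,F,C1) = 0`; `D1₂ = 0`, `det(e₂,F,D1) = 0`; `X₁ = 0`, `det(C1,X,D1) = 0`;
values — `(V_i)₃ = 0`; ones — `det(e₃,F,V_i) = 0 (i ∈ Eone)`;
addition — `(Qa_r)₂ = 0`, `det(X,V_j,Qa_r) = 0`, `det(e₁,F,H_r) = 0`, `det(V_i,Qa_r,H_r) = 0` for all
`r = (i,j,k)`, and `det(e₃,V_k,H_r) = 0` for `r ∈ Eadd`;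
multiplication — `(Qm_r)₂ = 0`, `det(X,V_j,Qm_r) = 0`, `(R_r)₁ = 0`, `det(C1,R_r,Qm_r) = 0`,
`(Q'_r)₂ = 0`, `det(V_i,R_r,Q'_r) = 0` for all `r`, and `det(X,V_k,Q'_r) = 0` for `r ∈ Emul`.
[cite: LeeVakil2012, §3; Mnev1988] -/
abbrev config (Eadd Emul : Finset (Fin N × Fin N × Fin N)) (Eone : Finset (Fin N)) :
    Set (Fin 3 → Fin 3 ⊕ (Unit ⊕ Kol N)) :=
  {entrySel _ 2 (Sum.inr (Sum.inl 0)), ![colE N 2, colF N, colC1 N],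
    entrySel _ 1 (Sum.inr (Sum.inl 1)), ![colE N 1, colF N, colD1 N],
    entrySel _ 0 (Sum.inr (Sum.inl 2)), ![colC1 N, colX N, colD1 N]}
  ∪ Set.range (fun i : Fin N => entrySel _ 2 (Sum.inr (Sum.inr (Sum.inl i))))
  ∪ (fun i : Fin N => ![colE N 2, colF N, colV N i]) '' ↑Eone
  ∪ Set.range (fun r : Fin N × Fin N × Fin N => entrySel _ 1 (Sum.inr (Sum.inr (Sum.inr (Sum.inl (r, 0))))))
  ∪ Set.range (fun r : Fin N × Fin N × Fin N => ![colX N, colV N r.2.1, colA N r 0])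
  ∪ Set.range (fun r : Fin N × Fin N × Fin N => ![colE N 0, colF N, colA N r 1])
  ∪ Set.range (fun r : Fin N × Fin N × Fin N => ![colV N r.1, colA N r 0, colA N r 1])
  ∪ (fun r : Fin N × Fin N × Fin N => ![colE N 2, colV N r.2.2, colA N r 1]) '' ↑Eadd
  ∪ Set.range (fun r : Fin N × Fin N × Fin N => entrySel _ 1 (Sum.inr (Sum.inr (Sum.inr (Sum.inr (r, 0))))))
  ∪ Set.range (fun r : Fin N × Fin N × Fin N => ![colX N, colV N r.2.1, colM N r 0])
  ∪ Set.range (fun r : Fin N × Fin N × Fin N => entrySel _ 0 (Sum.inr (Sum.inr (Sum.inr (Sum.inr (r, 1))))))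
  ∪ Set.range (fun r : Fin N × Fin N × Fin N => ![colC1 N, colM N r 1, colM N r 0])
  ∪ Set.range (fun r : Fin N × Fin N × Fin N => entrySel _ 1 (Sum.inr (Sum.inr (Sum.inr (Sum.inr (r, 2))))))
  ∪ Set.range (fun r : Fin N × Fin N × Fin N => ![colV N r.1, colM N r 1, colM N r 2])
  ∪ (fun r : Fin N × Fin N × Fin N => ![colX N, colV N r.2.2, colM N r 2]) '' ↑Emul

end Config

end Summit.ResolutionOfSingularities.ResolutionOfSingularities.Theorems.UniversalCells

end
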